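import Literature.Computability.Complexity.FoldBricks
import Literature.Computability.Complexity.GuardedBallStages
import HarnessLib

/-!
# Index-all bricks: the bounded conjunction `[∀ i < |h u|, c ⟨u, 1ⁱ⟩]` in the `FP` string algebra

Trunk `CplxCore`, brick assembly (no machine is programmed). A verifier that checks a condition
for every round / row / entry of its input runs a counted loop and ANDs one-bit answers; this file
proves the pattern once, on top of the generic fold loop `Brick.foldLoop` (`FoldBricks.lean`):

* `Brick.andOp ⟨[b], [b']⟩ = [b ∧ b']` (one-bit conjunction, additive growth);
* `Brick.allIdxFn h c` — from `u`, the bit `[∀ i < |h u|, c ⟨u, 1ⁱ⟩ = [1]]` for a one-bit test `c`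
  and a *yardstick* `h` with `|h u| ≤ |u|` (`allIdxFn_apply`, `allIdxFn_mem_FP`, `oneBit_allIdxFn`);
* **`ballLen_mem_P`**: for `T ∈ P`, `{w | ∀ j < |w|, ⟨w, 1ʲ⟩ ∈ T} ∈ P` (the case `h = id`,
  `c = Oracle.ofLanguage T`).

Used by the replay condition of Kabanets–Impagliazzo's Lemma 3 (`PRelOfFunNSUBEXP.lean`) and by the
validity test of integer-matrix codes (`QuantumComplexity/IntMatrixCanon.lean`).

## References

* S. Arora, B. Barak, *Computational Complexity: A Modern Approach*, CUP 2009, §1.3 (polynomial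
  time is closed under composition and bounded loops).
-/

namespace Literature.Computability.Complexity

open _root_.Computability Polynomial

namespace Brick

/-! ### One-bit conjunction -/

/-- The one-bit conjunction `⟨acc, b⟩ ↦ [acc.head ∧ b.head]`. [folklore] -/
noncomputable def andOp : List Bool → List Bool :=
  andFn (HashBricks.headBitFn ∘ fstF) (HashBricks.headBitFn ∘ sndF)

/-- Value of `andOp` on a pair of bits. [folklore] -/
@[simp] theorem andOp_boolPair (b b' : Bool) : andOp (boolPair [b] [b']) = [b && b'] := by
  rw [andOp, andFn_apply (b := b) (b' := b')] <;> simp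

/-- `andOp ∈ FP`. [folklore] -/
theorem andOp_mem_FP : andOp ∈ FP :=
  andFn_mem_FP (comp_mem_FP HashBricks.headBitFn_mem_FP fstF_mem_FP)
    (comp_mem_FP HashBricks.headBitFn_mem_FP sndF_mem_FP)

/-- `andOp` is one-bit. [folklore] -/
theorem oneBit_andOp : OneBit andOp :=
  oneBit_andFn ((HashBricks.oneBit_headBitFn).comp fstF) ((HashBricks.oneBit_headBitFn).comp sndF)

/-- `andOp` has one-symbol values (additive growth). [folklore] -/
theorem length_andOp_le (w : List Bool) : (andOp w).length ≤ (fstF w).length + (sndF w).length + 1 := by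
  rw [oneBit_andOp.length_eq]; omega

/-- **The conjunction fold of a one-bit test**: from the accumulator `[b]`, `k` rounds from index
`i₀` give `[b ∧ ∀ i < k, c ⟨u, 1^{i₀+i}⟩ = [1]]`. [folklore] -/
theorem foldAcc_andOp {c : List Bool → List Bool} (hc : OneBit c) (u : List Bool) :
    ∀ (k i₀ : ℕ) (b : Bool), foldAcc andOp c u i₀ k [b] =
      [b && decide (∀ i < k, c (boolPair u (ones (i₀ + i))) = [true])]
  | 0, i₀, b => by simp
  | k + 1, i₀, b => by
    obtain ⟨b', hb'⟩ := hc (boolPair u (ones i₀))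
    rw [foldAcc_succ, hb', andOp_boolPair, foldAcc_andOp hc u k (i₀ + 1)]
    congr 1
    rw [Bool.and_assoc]
    congr 1
    have hb'' : (c (boolPair u (ones i₀)) = [true]) ↔ b' = true := by rw [hb']; simp
    rw [show b' = decide (c (boolPair u (ones i₀)) = [true]) by rw [Bool.decide_congr hb'']; simp,
      ← Bool.decide_and]
    refine decide_eq_decide.mpr ⟨fun ⟨h0, h⟩ i hi => ?_, fun h => ⟨by simpa using h 0 (Nat.succ_pos k), fun i hi => ?_⟩⟩
    · rcases i with _ | i
      · simpa using h0
      · have := h i (by omega)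
        rwa [show i₀ + 1 + i = i₀ + (i + 1) by omega] at this
    · have := h (i + 1) (by omega)
      rwa [show i₀ + (i + 1) = i₀ + 1 + i by omega] at this

/-! ### The index-all loop -/

/-- **The index-all test** `allIdxFn h c u = [∀ i < |h u|, c ⟨u, 1ⁱ⟩ = [1]]`: `|h u|` rounds of the
conjunction fold of the one-bit test `c` (yardstick `h`, counter `bin |h u|`, accumulator `[1]`).
[cite: AroraBarakCC2009, §1.3 (bounded loops)] -/
noncomputable def allIdxFn (h c : List Bool → List Bool) : List Bool → List Bool :=
  sndPow 2 ∘ foldLoop andOp c X ∘ fanoutFn id (fanoutFn (lenBinF ∘ h) fun _ => boolPair [] [true])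

/-- **`allIdxFn h c ∈ FP`** for `h ∈ FP` and a one-bit `c ∈ FP`. [cite: AroraBarakCC2009, §1.3 (bounded loops)] -/
theorem allIdxFn_mem_FP {h c : List Bool → List Bool} (hh : h ∈ FP) (hcFP : c ∈ FP) (hc : OneBit c) :
    allIdxFn h c ∈ FP :=
  comp_mem_FP (sndPow_mem_FP 2)
    (comp_mem_FP
      (foldLoop_mem_FP andOp_mem_FP length_andOp_le hcFP (C := 1) (fun w => by rw [hc.length_eq]; omega) X)
      (fanoutFn_mem_FP OracleCompose.id_mem_FP (fanoutFn_mem_FP (comp_mem_FP lenBinF_mem_FP hh) (const_mem_FP _))))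

/-- **Value of the index-all test** when the yardstick fits (`|h u| ≤ |u|`). [folklore] -/
theorem allIdxFn_apply {h c : List Bool → List Bool} (hc : OneBit c) {u : List Bool} (hu : (h u).length ≤ u.length) :
    allIdxFn h c u = [decide (∀ i < (h u).length, c (boolPair u (ones i)) = [true])] := by
  have hinit : fanoutFn id (fanoutFn (lenBinF ∘ h) fun _ => boolPair [] [true]) u =
      boolPair u (boolPair (encodeNat (h u).length) (boolPair (ones 0) [true])) := by
    simp [ones]
  simp only [allIdxFn, Function.comp_apply, hinit]
  rw [foldLoop_apply andOp c (by simpa using hu) 0 [true], sndPow_succ_boolPair, sndPow_succ_boolPair,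
    sndPow_zero_boolPair, foldAcc_andOp hc]
  simp

/-- The index-all test is one-bit when the yardstick always fits. [folklore] -/
theorem oneBit_allIdxFn {h c : List Bool → List Bool} (hc : OneBit c) (hu : ∀ u, (h u).length ≤ u.length) :
    OneBit (allIdxFn h c) := fun u => ⟨_, allIdxFn_apply hc (hu u)⟩

/-! ### Bounded universal quantification over the rounds keeps `P` -/

/-- **For `T ∈ P`, `{w | ∀ j < |w|, ⟨w, 1ʲ⟩ ∈ T} ∈ P`** (the index-all loop of the indicator of
`T` with the input itself as yardstick). [cite: AroraBarakCC2009, §1.3 (bounded loops)] -/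
theorem ballLen_mem_P {T : Language Bool} (hT : T ∈ Classes.P) :
    {w | ∀ j < w.length, boolPair w (ones j) ∈ T} ∈ Classes.P := by
  classical
  have hc := GuardedBall.oneBit_ofLanguage T
  have hval : ∀ w, allIdxFn id (Oracle.ofLanguage T) w = [decide (∀ j < w.length, boolPair w (ones j) ∈ T)] := by
    intro w
    rw [allIdxFn_apply hc (h := id) le_rfl]
    simp only [id, GuardedBall.ofLanguage_apply_decide, List.cons.injEq, and_true, decide_eq_true_eq]
  refine mem_P_of_mem_FP (allIdxFn_mem_FP OracleCompose.id_mem_FP (GuardedBall.ofLanguage_mem_FP_of_mem_P hT) hc) _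
    fun w => ⟨fun h => ?_, fun h => ?_⟩
  · rw [hval, decide_eq_true (show ∀ j < w.length, boolPair w (ones j) ∈ T from h)]
  · rw [hval, decide_eq_false (show ¬ ∀ j < w.length, boolPair w (ones j) ∈ T from h)]

end Brick

end Literature.Computability.Complexity
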